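import Summits.QuantumFields.YangMills.Theorems.BalabanUVNodesN09HierarchyBindersOfLevelwiseThm1
import Summits.QuantumFields.YangMills.Theorems.BalabanUVNodesN09AxialCovariance181OnDomainsReg8Nesting
import Summits.QuantumFields.YangMills.Theorems.BalabanUVNodesN09TwoRadiiDoorForall

/-!
# NODE N09 [B12] — THE TWO N09 DOORS THAT N24 READS (dag-n09-w2's ON-DOMAINS DOOR v1.2 = the AXIAL road; dag-n09-w3's TWO-RADII `∀ P` DOOR = the COVARIANT road) WITH THE
# HIERARCHICAL [B11] BINDERS `hres` ∕ `huniq` DISCHARGED (and, in §2, the second-radius clause `hreg8` as well): N24's `h09T` child reads [B11] Theorem 1 as {the LEVEL-WISE `h11`,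
# N07's Theorem-1 slot AT OBJECTS `hT1`, NODE 00's ₈a rows `hUk`} + numerics — nothing hierarchical

Cell `pub-ymgap` (YM-PLAN Track A, node N09 of 28), width seat `pub-ymgap-dag-n09-w1` (generation 7), FILE 2 — the DOOR sequel of FILE 1 `…N09HierarchyBindersOfLevelwiseThm1` (this seat, same
generation): helper of K1⁹ `StabilityBRunRowsAtRecordR13SepCoPHV` = stmt-QuantumFields-27364 (`--supports`, `--as helper`, count-neutral).  [I] = [Balaban1987RG1] (CMP 109),
[B7] = [Balaban1985Averaging] (CMP 98), [B11] = [Balaban1985Variational] (CMP 102).  Imports FILE 1, dag-n09-w2's v1.2 on-domains door `…N09AxialCovariance181OnDomainsReg8Nesting` (p601129;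
the door of §1 of dag-n24-c's `…N24ChildrenSplitN09Suppliers`) and dag-n09-w3's `…N09TwoRadiiDoorForall` (p604132; the `∀ P` form of the covariant two-radii door).  THEOREMS ONLY (0 `def`, 0 `instance`, 0 `notation`, 0 `sorry`); each proof is ONE application of the v1.2 door with the
hierarchical binders supplied by FILE 1.

CONTENT.
* §1 ★★★ `thm3Member_forall_stage13SepCoPH_onDomains_of_axialOn_of_thm1Objects_of_suppPt` — the v1.2 door `thm3Member_forall_stage13SepCoPH_onDomains_of_axialOn_of_reg8_of_suppPt` with
  `hres ↦ FILE 1 hres_of_thm1Objects_of_ukRows_of_reg8` and `huniq ↦ FILE 1 huniq_of_h11`.  Displayed, per run `P`: `hreg8`, `hle`, `hεreg`, `haxDom`, `haxbg`, (F7a) `hχregpt`, (I19) `hint`,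
  the LEVEL-WISE `h11`, N07's Theorem-1 slot AT OBJECTS `hT1` and ₈a's rows `hUk` at every member `(P.K, k)`, `k ≤ P.K`, radius `θ.εbg` (dag-n21-c p454585 currency — VERBATIM the hypotheses of
  this seat's g2 FILE 3), `0 < θ.ε₂₉`, `0 < θ.εbg`, the (53)-numerics at `θ.εbg`, and the NEW letters `0 ≤ B₃`, `0 < θ.ν.εreg`, `2θ.ν.εreg ≤ a₁`, `2B₃·θ.ν.εreg ≤ θ.εbg ≤ a₀` ((53) at `εreg`
  follows from (53) at `εbg ≥ εreg`).  `b12_main_forall_…` = `Dag.B12_main` at every run from N09's own leaf (dag-n09-a `b12_main_of_leaf_of_thm3Member`).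
* §2 ★★ `thm3Member_forall_stage13SepCoPH_onDomains_of_axialOn_of_thm1Objects_of_suppPt'` — the same with `hreg8` ALSO discharged (g2 FILE 3 `hreg8_of_thm1Objects_of_ukRows`, three more
  letters `0 < θ.ν.ε₀ ≤ a₁`, `B₃·θ.ν.ε₀ ≤ θ.ν.εreg`): the door's [B11]∕two-radii content is then EXACTLY {`h11`, `hT1`, `hUk`} + numerics.
* §3 ★★★ `thm3Member_forall_stage13SepCoPH_atDomAlt_of_thm1Objects_of_reg8` — THE COVARIANT ROAD: dag-n09-w3's `…N09TwoRadiiDoorForall.thm3Member_forall_stage13SepCoPH_atDomAlt_of_thm1_of_reg8`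
  (p604132: `hε hreg8 hle hεreg`, (181)ˢᵒˡ `hcov`, `hχdom`, (I19) `hint`, `hreg`, [B11] ×3) with `hres`∕`huniq` DISCHARGED the same way; that door carried NO (53)-numerics, so the letters
  `0 < θ.εbg`, (53) at `θ.εbg`, `2θ.εbg ≤ θ.ν.ε₀L²` enter here together with `hT1`∕`hUk` and the two-radii letters.

LOCATED (not this seat's to re-point).  The object slots at levels `k ≥ 1` are Bałaban's Theorem 1 (N07's content, proved nowhere in the tree); the D-defB-1 divergence of `h11`'s uniqueness half
(plaquette class vs. (2)-class) is untouched; at the V18∕V19 witness `θ₁₃ᶜᶜᴹᵂ` (`εbg = 1 > a₀`) the letter `θ.εbg ≤ a₀` fails like every print-regime letter there (g2 FILE 3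
`not_εbg_le_a₀_theta13OfThm1CCMW`) — the doors here are for print-admissible re-keyings (`εbg := a₀`, `εreg ≤ a₀∕(2B₃)`).

HONEST FRAMING — what this is NOT.  Count-neutral composition BY NAME; [B11] Theorem 1 enters ONLY as displayed hypotheses (`h11`, `hT1`, `hUk`); NOTHING of Bałaban's asserted; NO carrier of record
re-pointed; `hreg`-type analytic provisos of the v1.2 door are exactly as dag-n09-w2 displayed them (`hχregpt`, `hint`, axiality conventions); N09 NOT discharged; conjunct 1 (Lemma 4) ∕ FLAG №7
untouched; K0⁷ ∕ K1⁹ ∕ K3⁸ NOT closed; counts unmoved (typed 28∕28 · discharged 5∕28); no summit statement is proved by this seat; one finite four-torus programme at fixed `ε = L^{−K}` per run —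
R4 closes the conditional rung `BalabanLadder.UV` only; NOT continuum ∕ ℝ⁴ ∕ infinite volume ∕ OS; the Yang–Mills mass gap (Clay) is NOT proved by any of this.
-/

noncomputable section

namespace Summit.QuantumFields.YangMills.BalabanUVNodes.N09OnDomainsDoorOfLevelwiseThm1

open MeasureTheory
open Literature.MathematicalPhysics.QuantumFieldTheory.Balaban1983to89
open Literature.MathematicalPhysics.QuantumFieldTheory.Balaban1983to89.T4Continuum (T4Family)
open Literature.MathematicalPhysics.QuantumFieldTheory.Balaban1983to89.Node00
open Literature.MathematicalPhysics.QuantumFieldTheory.Balaban1983to89.ExpMeanLog (deltaSU)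
open Literature.MathematicalPhysics.QuantumFieldTheory.Balaban1983to89.B12GaugeOrbits021 (OrbitRel)
open DagBinding
open B12NodeKnitRecord8 (b12_main_of_leaf_of_thm3Member)
open Summit.QuantumFields.YangMills.BalabanUVNodes.N09AxialCovariance181OnDomainsReg8Nesting (thm3Member_forall_stage13SepCoPH_onDomains_of_axialOn_of_reg8_of_suppPt)
open Summit.QuantumFields.YangMills.BalabanUVNodes.N09TwoRadiiDoorForall (thm3Member_forall_stage13SepCoPH_atDomAlt_of_thm1_of_reg8)
open B12RTGaugeInvariance254 (liftTransf)
open GaugeField (gaugeAct)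
open Summit.QuantumFields.YangMills.BalabanUVNodes.N09HierarchyBindersOfLevelwiseThm1 (hres_of_thm1Objects_of_ukRows_of_reg8 huniq_of_h11)
open Summit.QuantumFields.YangMills.BalabanUVNodes.N09BackgroundRadiiReg8OfThm1Objects (hreg8_of_thm1Objects_of_ukRows)

variable {F : T4Family} {N : ℕ} [NeZero N]

/-! ## §1  The v1.2 on-domains door with `hres` and `huniq` discharged -/

/-- ★★★ **N24's `h09T` AT A WORLD BOUND TO THE STAGE-13 v1.7 `SepCoPH` CONSTRUCTION, ON THE SMALL-FIELD DOMAINS — dag-n09-w2's door v1.2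
(`…OnDomainsReg8Nesting.thm3Member_forall_stage13SepCoPH_onDomains_of_axialOn_of_reg8_of_suppPt`, p601129) WITH THE TWO HIERARCHICAL [B11] BINDERS `hres`∕`huniq` DISCHARGED** (FILE 1
`hres_of_thm1Objects_of_ukRows_of_reg8` ∕ `huniq_of_h11`).  Displayed, per run `P`: `hreg8`, `hle`, `hεreg`, `haxDom`, `haxbg`, (F7a) `hχregpt`, (I19) `hint`, the LEVEL-WISE `h11`, N07's
Theorem-1 slot AT OBJECTS `hT1` and NODE 00's ₈a rows `hUk` for every member `(P.K, k)`, `k ≤ P.K`, at radius `θ.εbg` (dag-n21-c p454585 currency), `0 < θ.ε₂₉`, `0 < θ.εbg`, the (53)-numerics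
at `θ.εbg`, and the NEW numerics letters `0 ≤ B₃`, `0 < θ.ν.εreg`, `2θ.ν.εreg ≤ a₁`, `2B₃·θ.ν.εreg ≤ θ.εbg ≤ a₀`.  CONDITIONAL on every displayed hypothesis; nothing of Bałaban's asserted;
N09 NOT discharged; K1⁹ NOT closed. [cite: Balaban1987RG1, Thm 3 p.264, (1.1)–(1.3) p.260, (2.1)–(2.3) p.265, (2.9)–(2.10) pp.266–267; Balaban1985Variational, Thm 1 (6), (8)–(10) p.279 and (181) p.307; Balaban1985Averaging, Prop. 2 (53) p.26] -/
theorem thm3Member_forall_stage13SepCoPH_onDomains_of_axialOn_of_thm1Objects_of_suppPt (θ : Stage13HParams F N) (h : θ.Provisos₁₃SepCoPH F N)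
    {w : WorldP} (hC : w.C = (datumOfRecord₁₃SepCoPH F N θ h).C) (cd : (P : B12.RunParams) → (j : ℕ) → ContourData (F.P P.K) j (SU N))
    {a₀ a₁ B₃ : ℝ}
    (hT1 : ∀ (P : B12.RunParams) (k : ℕ), k ≤ P.K → ∀ ε₁ : ℝ, 0 < ε₁ → ε₁ ≤ a₁ → ∀ V : GaugeField (F.P P.K) k (SU N), PlaqSmall ε₁ V →
      (∃ U : GaugeField (F.P P.K) 0 (SU N), IsBackground (avOfRecord F N P.K) {U | InUkClassB11 F N P.K k (B₃ * ε₁) U} k V U) ∧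
      (∀ ε₀ : ℝ, B₃ * ε₁ ≤ ε₀ → ε₀ ≤ a₀ → ∀ U U' : GaugeField (F.P P.K) 0 (SU N),
          IsBackground (avOfRecord F N P.K) {U | InUkClassB11 F N P.K k (B₃ * ε₁) U} k V U →
          IsBackground (avOfRecord F N P.K) {U | InUkClassB11 F N P.K k ε₀ U} k V U' → InUkClassB11 F N P.K k ε₀ U ∧ OrbitRel k U U'))
    (hUk : ∀ (P : B12.RunParams) (k : ℕ), k ≤ P.K → ∀ (V : GaugeField (F.P P.K) k (SU N)) (δ : ℝ), 0 < δ → δ ≤ a₁ → B₃ * δ ≤ θ.εbg → PlaqSmall δ V →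
      UkExists F N P.K k θ.εbg V ∧ InUkClassB11 F N P.K k θ.εbg (Uk F N P.K k θ.εbg V))
    (hreg8 : ∀ (P : B12.RunParams) (k : ℕ), k ≤ P.K → ∀ V ∈ domAltOfRecord F N θ.ν P.K k, Uk F N P.K k θ.εbg V ∈ bgReg F N P.K k θ.ν.εreg)
    (hle : θ.ν.εreg ≤ θ.εbg) (hεreg : 0 ≤ θ.ν.εreg)
    (haxDom : ∀ (P : B12.RunParams), ∀ j < P.K, ∀ W ∈ domAltOfRecord F N θ.ν P.K (j + 1), AxialGauge (cd P j) (critCfgOfRecord F N θ.ν P.K j W))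
    (haxbg : ∀ (P : B12.RunParams) (k : ℕ), k ≤ P.K → ∀ V ∈ domAltOfRecord F N θ.ν P.K k, ∀ j < k,
      AxialGauge (cd P j) (Averaging.iter (avOfRecord F N P.K) j (Uk F N P.K k θ.εbg V)))
    (hχregpt : ∀ (P : B12.RunParams) (i : ℕ), i + 1 < P.K → ∀ U : GaugeField (F.P P.K) (i + 1) (SU N),
      (avOfRecord F N P.K (i + 1)).avg U ∈ domAltOfRecord F N θ.ν P.K (i + 2) →
        U ∉ regSetOfRecord F N P.K i (betaInputOfRecord F N (TβOfRecord₁₃ F N) (chiβOfRecord₁₃ F N θ.toStage13Params) P.K (gOfRecord₁₃ F N θ.toStage13Params P) i) ∩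
            domAltOfRecord F N θ.ν P.K (i + 1) →
          chiβOfRecord₁₃ F N θ.toStage13Params P.K (gOfRecord₁₃ F N θ.toStage13Params P) (i + 1) U = 0)
    (hint : ∀ (P : B12.RunParams), ∀ j < P.K, Integrable (betaInputOfRecord F N (TβOfRecord₁₃ F N) (chiβOfRecord₁₃ F N θ.toStage13Params) P.K
      (gOfRecord₁₃ F N θ.toStage13Params P) j) (fieldMeasure (F.P P.K) j (SU N)))
    (h11 : ∀ (P : B12.RunParams) (k : ℕ), k ≤ P.K → ∀ V ∈ domAltOfRecord F N θ.ν P.K k, UkExists F N P.K k θ.εbg V ∧ UniqueUkOrbit F N P.K k θ.εbg V)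
    (hεχ : 0 < θ.ε₂₉) (hε : 0 < θ.εbg)
    (hε3 : ∀ P : B12.RunParams, (143 * (((((F.P P.K).d + 4 : ℕ) : ℝ)) ^ 2 / 4) ^ 2) * θ.εbg ≤ 1 / 3)
    (hε2 : ∀ P : B12.RunParams, 2 * θ.εbg ≤ 2 * deltaSU (Fin N) / ((((F.P P.K).d + 4) * (F.P P.K).L : ℕ) : ℝ) ^ 2)
    (hε₀ : ∀ P : B12.RunParams, 2 * θ.εbg ≤ θ.ν.ε₀ * ((F.P P.K).L : ℝ) ^ 2)
    (hB₃ : 0 ≤ B₃) (hεreg' : 0 < θ.ν.εreg) (hra : 2 * θ.ν.εreg ≤ a₁) (hB : 2 * B₃ * θ.ν.εreg ≤ θ.εbg) (hhi : θ.εbg ≤ a₀) :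
    ∀ P : B12.RunParams, (leavesP w P).smallCouplings → (leavesP w P).smallFieldInductive := by
  have hr3 : ∀ P : B12.RunParams, (143 * (((((F.P P.K).d + 4 : ℕ) : ℝ)) ^ 2 / 4) ^ 2) * θ.ν.εreg ≤ 1 / 3 :=
    fun P => (mul_le_mul_of_nonneg_left hle (by positivity)).trans (hε3 P)
  have hr2 : ∀ P : B12.RunParams, 2 * θ.ν.εreg ≤ 2 * deltaSU (Fin N) / ((((F.P P.K).d + 4) * (F.P P.K).L : ℕ) : ℝ) ^ 2 :=
    fun P => (by linarith : 2 * θ.ν.εreg ≤ 2 * θ.εbg).trans (hε2 P)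
  exact thm3Member_forall_stage13SepCoPH_onDomains_of_axialOn_of_reg8_of_suppPt θ h hC cd hreg8 hle hεreg haxDom haxbg hχregpt hint h11
    (fun P k hk => hres_of_thm1Objects_of_ukRows_of_reg8 θ.ν θ.εbg a₀ a₁ B₃ P.K (hT1 P) (hUk P) (fun k hk V hV => (h11 P k hk V hV).1)
      (hreg8 P) hB₃ hεreg' (hr3 P) (hr2 P) hra hB hhi k hk)
    (fun P => huniq_of_h11 θ.ν hε (hε3 P) (hε2 P) (hε₀ P) (h11 P)) hεχ hε hε3 hε2 hε₀

/-- **N09 = `Dag.B12_main` AT EVERY RUN OF A WORLD BOUND TO THE STAGE-13 v1.7 CONSTRUCTION**, §1's door, from N09's own leaf `b12` ([I] Lemma 4) (dag-n09-a `b12_main_of_leaf_of_thm3Member`).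
CONDITIONAL; N09 NOT discharged. [cite: Balaban1987RG1, Lemma 4 (3.53) p.280, Thm 3 p.264 and (1.1) p.260; Balaban1985Variational, Thm 1 (6) and (8) p.279] -/
theorem b12_main_forall_stage13SepCoPH_onDomains_of_axialOn_of_thm1Objects_of_suppPt (θ : Stage13HParams F N) (h : θ.Provisos₁₃SepCoPH F N)
    {w : WorldP} (hC : w.C = (datumOfRecord₁₃SepCoPH F N θ h).C) (h12 : ∀ P : B12.RunParams, (leavesP w P).b12)
    (cd : (P : B12.RunParams) → (j : ℕ) → ContourData (F.P P.K) j (SU N)) {a₀ a₁ B₃ : ℝ}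
    (hT1 : ∀ (P : B12.RunParams) (k : ℕ), k ≤ P.K → ∀ ε₁ : ℝ, 0 < ε₁ → ε₁ ≤ a₁ → ∀ V : GaugeField (F.P P.K) k (SU N), PlaqSmall ε₁ V →
      (∃ U : GaugeField (F.P P.K) 0 (SU N), IsBackground (avOfRecord F N P.K) {U | InUkClassB11 F N P.K k (B₃ * ε₁) U} k V U) ∧
      (∀ ε₀ : ℝ, B₃ * ε₁ ≤ ε₀ → ε₀ ≤ a₀ → ∀ U U' : GaugeField (F.P P.K) 0 (SU N),
          IsBackground (avOfRecord F N P.K) {U | InUkClassB11 F N P.K k (B₃ * ε₁) U} k V U →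
          IsBackground (avOfRecord F N P.K) {U | InUkClassB11 F N P.K k ε₀ U} k V U' → InUkClassB11 F N P.K k ε₀ U ∧ OrbitRel k U U'))
    (hUk : ∀ (P : B12.RunParams) (k : ℕ), k ≤ P.K → ∀ (V : GaugeField (F.P P.K) k (SU N)) (δ : ℝ), 0 < δ → δ ≤ a₁ → B₃ * δ ≤ θ.εbg → PlaqSmall δ V →
      UkExists F N P.K k θ.εbg V ∧ InUkClassB11 F N P.K k θ.εbg (Uk F N P.K k θ.εbg V))
    (hreg8 : ∀ (P : B12.RunParams) (k : ℕ), k ≤ P.K → ∀ V ∈ domAltOfRecord F N θ.ν P.K k, Uk F N P.K k θ.εbg V ∈ bgReg F N P.K k θ.ν.εreg)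
    (hle : θ.ν.εreg ≤ θ.εbg) (hεreg : 0 ≤ θ.ν.εreg)
    (haxDom : ∀ (P : B12.RunParams), ∀ j < P.K, ∀ W ∈ domAltOfRecord F N θ.ν P.K (j + 1), AxialGauge (cd P j) (critCfgOfRecord F N θ.ν P.K j W))
    (haxbg : ∀ (P : B12.RunParams) (k : ℕ), k ≤ P.K → ∀ V ∈ domAltOfRecord F N θ.ν P.K k, ∀ j < k,
      AxialGauge (cd P j) (Averaging.iter (avOfRecord F N P.K) j (Uk F N P.K k θ.εbg V)))
    (hχregpt : ∀ (P : B12.RunParams) (i : ℕ), i + 1 < P.K → ∀ U : GaugeField (F.P P.K) (i + 1) (SU N),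
      (avOfRecord F N P.K (i + 1)).avg U ∈ domAltOfRecord F N θ.ν P.K (i + 2) →
        U ∉ regSetOfRecord F N P.K i (betaInputOfRecord F N (TβOfRecord₁₃ F N) (chiβOfRecord₁₃ F N θ.toStage13Params) P.K (gOfRecord₁₃ F N θ.toStage13Params P) i) ∩
            domAltOfRecord F N θ.ν P.K (i + 1) →
          chiβOfRecord₁₃ F N θ.toStage13Params P.K (gOfRecord₁₃ F N θ.toStage13Params P) (i + 1) U = 0)
    (hint : ∀ (P : B12.RunParams), ∀ j < P.K, Integrable (betaInputOfRecord F N (TβOfRecord₁₃ F N) (chiβOfRecord₁₃ F N θ.toStage13Params) P.K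
      (gOfRecord₁₃ F N θ.toStage13Params P) j) (fieldMeasure (F.P P.K) j (SU N)))
    (h11 : ∀ (P : B12.RunParams) (k : ℕ), k ≤ P.K → ∀ V ∈ domAltOfRecord F N θ.ν P.K k, UkExists F N P.K k θ.εbg V ∧ UniqueUkOrbit F N P.K k θ.εbg V)
    (hεχ : 0 < θ.ε₂₉) (hε : 0 < θ.εbg)
    (hε3 : ∀ P : B12.RunParams, (143 * (((((F.P P.K).d + 4 : ℕ) : ℝ)) ^ 2 / 4) ^ 2) * θ.εbg ≤ 1 / 3)
    (hε2 : ∀ P : B12.RunParams, 2 * θ.εbg ≤ 2 * deltaSU (Fin N) / ((((F.P P.K).d + 4) * (F.P P.K).L : ℕ) : ℝ) ^ 2)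
    (hε₀ : ∀ P : B12.RunParams, 2 * θ.εbg ≤ θ.ν.ε₀ * ((F.P P.K).L : ℝ) ^ 2)
    (hB₃ : 0 ≤ B₃) (hεreg' : 0 < θ.ν.εreg) (hra : 2 * θ.ν.εreg ≤ a₁) (hB : 2 * B₃ * θ.ν.εreg ≤ θ.εbg) (hhi : θ.εbg ≤ a₀) :
    ∀ P : B12.RunParams, Dag.B12_main (leavesP w P) :=
  fun P => b12_main_of_leaf_of_thm3Member (h12 P)
    (thm3Member_forall_stage13SepCoPH_onDomains_of_axialOn_of_thm1Objects_of_suppPt θ h hC cd hT1 hUk hreg8 hle hεreg haxDom haxbg hχregpt hint h11 hεχ hε hε3 hε2 hε₀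
      hB₃ hεreg' hra hB hhi P)

/-! ## §2  … and with the second-radius clause `hreg8` discharged too (g2 FILE 3) -/

/-- ★★ **THE SAME DOOR WITH `hreg8` ALSO DISCHARGED** (this seat's g2 FILE 3 `hreg8_of_thm1Objects_of_ukRows`: ₈a's row read at `δ := θ.ν.ε₀` and (8) at the member, with the three letters
`0 < θ.ν.ε₀ ≤ a₁`, `B₃·θ.ν.ε₀ ≤ θ.ν.εreg`): the door's [B11] ∕ two-radii content is then EXACTLY the level-wise `h11` + N07's Theorem-1 slot at objects `hT1` + ₈a's rows `hUk` + numerics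
(`θ.ν.εreg ≤ θ.εbg ≤ a₀`, `2B₃·θ.ν.εreg ≤ θ.εbg`, `2θ.ν.εreg ≤ a₁`, `0 < θ.ν.εreg`, `0 ≤ B₃`, the (53)-letters and `2θ.εbg ≤ θ.ν.ε₀L²` at `θ.εbg`).  CONDITIONAL; nothing of Bałaban's asserted;
N09 NOT discharged; K1⁹ NOT closed. [cite: Balaban1987RG1, Thm 3 p.264, (1.1)–(1.3) p.260, (2.1)–(2.3) p.265; Balaban1985Variational, Thm 1 (6), (8)–(10) p.279; Balaban1985Averaging, Prop. 2 (53) p.26] -/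
theorem thm3Member_forall_stage13SepCoPH_onDomains_of_axialOn_of_thm1Objects_of_suppPt' (θ : Stage13HParams F N) (h : θ.Provisos₁₃SepCoPH F N)
    {w : WorldP} (hC : w.C = (datumOfRecord₁₃SepCoPH F N θ h).C) (cd : (P : B12.RunParams) → (j : ℕ) → ContourData (F.P P.K) j (SU N))
    {a₀ a₁ B₃ : ℝ}
    (hT1 : ∀ (P : B12.RunParams) (k : ℕ), k ≤ P.K → ∀ ε₁ : ℝ, 0 < ε₁ → ε₁ ≤ a₁ → ∀ V : GaugeField (F.P P.K) k (SU N), PlaqSmall ε₁ V →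
      (∃ U : GaugeField (F.P P.K) 0 (SU N), IsBackground (avOfRecord F N P.K) {U | InUkClassB11 F N P.K k (B₃ * ε₁) U} k V U) ∧
      (∀ ε₀ : ℝ, B₃ * ε₁ ≤ ε₀ → ε₀ ≤ a₀ → ∀ U U' : GaugeField (F.P P.K) 0 (SU N),
          IsBackground (avOfRecord F N P.K) {U | InUkClassB11 F N P.K k (B₃ * ε₁) U} k V U →
          IsBackground (avOfRecord F N P.K) {U | InUkClassB11 F N P.K k ε₀ U} k V U' → InUkClassB11 F N P.K k ε₀ U ∧ OrbitRel k U U'))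
    (hUk : ∀ (P : B12.RunParams) (k : ℕ), k ≤ P.K → ∀ (V : GaugeField (F.P P.K) k (SU N)) (δ : ℝ), 0 < δ → δ ≤ a₁ → B₃ * δ ≤ θ.εbg → PlaqSmall δ V →
      UkExists F N P.K k θ.εbg V ∧ InUkClassB11 F N P.K k θ.εbg (Uk F N P.K k θ.εbg V))
    (hle : θ.ν.εreg ≤ θ.εbg)
    (haxDom : ∀ (P : B12.RunParams), ∀ j < P.K, ∀ W ∈ domAltOfRecord F N θ.ν P.K (j + 1), AxialGauge (cd P j) (critCfgOfRecord F N θ.ν P.K j W))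
    (haxbg : ∀ (P : B12.RunParams) (k : ℕ), k ≤ P.K → ∀ V ∈ domAltOfRecord F N θ.ν P.K k, ∀ j < k,
      AxialGauge (cd P j) (Averaging.iter (avOfRecord F N P.K) j (Uk F N P.K k θ.εbg V)))
    (hχregpt : ∀ (P : B12.RunParams) (i : ℕ), i + 1 < P.K → ∀ U : GaugeField (F.P P.K) (i + 1) (SU N),
      (avOfRecord F N P.K (i + 1)).avg U ∈ domAltOfRecord F N θ.ν P.K (i + 2) →
        U ∉ regSetOfRecord F N P.K i (betaInputOfRecord F N (TβOfRecord₁₃ F N) (chiβOfRecord₁₃ F N θ.toStage13Params) P.K (gOfRecord₁₃ F N θ.toStage13Params P) i) ∩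
            domAltOfRecord F N θ.ν P.K (i + 1) →
          chiβOfRecord₁₃ F N θ.toStage13Params P.K (gOfRecord₁₃ F N θ.toStage13Params P) (i + 1) U = 0)
    (hint : ∀ (P : B12.RunParams), ∀ j < P.K, Integrable (betaInputOfRecord F N (TβOfRecord₁₃ F N) (chiβOfRecord₁₃ F N θ.toStage13Params) P.K
      (gOfRecord₁₃ F N θ.toStage13Params P) j) (fieldMeasure (F.P P.K) j (SU N)))
    (h11 : ∀ (P : B12.RunParams) (k : ℕ), k ≤ P.K → ∀ V ∈ domAltOfRecord F N θ.ν P.K k, UkExists F N P.K k θ.εbg V ∧ UniqueUkOrbit F N P.K k θ.εbg V)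
    (hεχ : 0 < θ.ε₂₉) (hε : 0 < θ.εbg)
    (hε3 : ∀ P : B12.RunParams, (143 * (((((F.P P.K).d + 4 : ℕ) : ℝ)) ^ 2 / 4) ^ 2) * θ.εbg ≤ 1 / 3)
    (hε2 : ∀ P : B12.RunParams, 2 * θ.εbg ≤ 2 * deltaSU (Fin N) / ((((F.P P.K).d + 4) * (F.P P.K).L : ℕ) : ℝ) ^ 2)
    (hε₀ : ∀ P : B12.RunParams, 2 * θ.εbg ≤ θ.ν.ε₀ * ((F.P P.K).L : ℝ) ^ 2)
    (hB₃ : 0 ≤ B₃) (hνε₀ : 0 < θ.ν.ε₀) (hνε₀a : θ.ν.ε₀ ≤ a₁) (hB₀ : B₃ * θ.ν.ε₀ ≤ θ.ν.εreg)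
    (hεreg' : 0 < θ.ν.εreg) (hra : 2 * θ.ν.εreg ≤ a₁) (hB : 2 * B₃ * θ.ν.εreg ≤ θ.εbg) (hhi : θ.εbg ≤ a₀) :
    ∀ P : B12.RunParams, (leavesP w P).smallCouplings → (leavesP w P).smallFieldInductive :=
  thm3Member_forall_stage13SepCoPH_onDomains_of_axialOn_of_thm1Objects_of_suppPt θ h hC cd hT1 hUk
    (fun P => hreg8_of_thm1Objects_of_ukRows θ.ν θ.εbg a₀ a₁ B₃ P.K (hT1 P) (hUk P) hνε₀ hνε₀a hB₀ hle hhi)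
    hle hεreg'.le haxDom haxbg hχregpt hint h11 hεχ hε hε3 hε2 hε₀ hB₃ hεreg' hra hB hhi

/-! ## §3  The covariant road: dag-n09-w3's two-radii `∀ P` door with `hres` and `huniq` discharged -/

/-- ★★★ **THE COVARIANT TWO-RADII DOOR (dag-n09-w3 `…N09TwoRadiiDoorForall.thm3Member_forall_stage13SepCoPH_atDomAlt_of_thm1_of_reg8`, p604132) WITH `hres`∕`huniq` DISCHARGED**
(FILE 1 `hres_of_thm1Objects_of_ukRows_of_reg8` ∕ `huniq_of_h11`).  Displayed, per run `P`: `hε : 0 < θ.ε₂₉`, `hreg8`, `hle`, `hεreg`, (181)ˢᵒˡ `hcov`, the support clause `hχdom`, (I19)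
`hint`, the regularity inclusion `hreg`, the LEVEL-WISE `h11`, N07's Theorem-1 slot AT OBJECTS `hT1` + ₈a's rows `hUk` at every member `(P.K, k)` (radius `θ.εbg`), and the numerics letters
`0 < θ.εbg`, (53) at `θ.εbg`, `2θ.εbg ≤ θ.ν.ε₀·L²`, `0 ≤ B₃`, `0 < θ.ν.εreg`, `2θ.ν.εreg ≤ a₁`, `2B₃·θ.ν.εreg ≤ θ.εbg ≤ a₀`.  CONDITIONAL on every displayed hypothesis; nothing of Bałaban's
asserted; N09 NOT discharged; K1⁹ NOT closed. [cite: Balaban1987RG1, Thm 3 p.264, p.259, (1.1)–(1.3) p.260, (2.1)–(2.3) p.265, (2.9)–(2.10) pp.266–267; Balaban1985Variational, Thm 1 (6), (8)–(10) p.279 and (181) p.307; Balaban1985Averaging, Prop. 2 (53) p.26] -/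
theorem thm3Member_forall_stage13SepCoPH_atDomAlt_of_thm1Objects_of_reg8 (θ : Stage13HParams F N) (h : θ.Provisos₁₃SepCoPH F N) {w : WorldP}
    (hC : w.C = (datumOfRecord₁₃SepCoPH F N θ h).C) (hε : 0 < θ.ε₂₉) {a₀ a₁ B₃ : ℝ}
    (hT1 : ∀ (P : B12.RunParams) (k : ℕ), k ≤ P.K → ∀ ε₁ : ℝ, 0 < ε₁ → ε₁ ≤ a₁ → ∀ V : GaugeField (F.P P.K) k (SU N), PlaqSmall ε₁ V →
      (∃ U : GaugeField (F.P P.K) 0 (SU N), IsBackground (avOfRecord F N P.K) {U | InUkClassB11 F N P.K k (B₃ * ε₁) U} k V U) ∧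
      (∀ ε₀ : ℝ, B₃ * ε₁ ≤ ε₀ → ε₀ ≤ a₀ → ∀ U U' : GaugeField (F.P P.K) 0 (SU N),
          IsBackground (avOfRecord F N P.K) {U | InUkClassB11 F N P.K k (B₃ * ε₁) U} k V U →
          IsBackground (avOfRecord F N P.K) {U | InUkClassB11 F N P.K k ε₀ U} k V U' → InUkClassB11 F N P.K k ε₀ U ∧ OrbitRel k U U'))
    (hUk : ∀ (P : B12.RunParams) (k : ℕ), k ≤ P.K → ∀ (V : GaugeField (F.P P.K) k (SU N)) (δ : ℝ), 0 < δ → δ ≤ a₁ → B₃ * δ ≤ θ.εbg → PlaqSmall δ V →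
      UkExists F N P.K k θ.εbg V ∧ InUkClassB11 F N P.K k θ.εbg (Uk F N P.K k θ.εbg V))
    (hreg8 : ∀ (P : B12.RunParams) (k : ℕ), k ≤ P.K → ∀ V ∈ domAltOfRecord F N θ.ν P.K k, Uk F N P.K k θ.εbg V ∈ bgReg F N P.K k θ.toStage13Params.ν.εreg)
    (hle : θ.toStage13Params.ν.εreg ≤ θ.εbg) (hεreg : 0 ≤ θ.toStage13Params.ν.εreg)
    (hcov : ∀ (P : B12.RunParams), ∀ j < P.K, ∀ (v : GaugeTransf (F.P P.K) (j + 1) (SU N)) (W : GaugeField (F.P P.K) (j + 1) (SU N)),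
      UkExists F N P.K (j + 1) θ.toStage13Params.ν.εreg W →
        critCfgOfRecord F N θ.toStage13Params.ν P.K j (gaugeAct v W) = gaugeAct (liftTransf v) (critCfgOfRecord F N θ.toStage13Params.ν P.K j W))
    (hχdom : ∀ (P : B12.RunParams), ∀ j < P.K, ∀ U : GaugeField (F.P P.K) j (SU N), (avOfRecord F N P.K j).avg U ∈ domAltOfRecord F N θ.ν P.K (j + 1) →
      U ∉ domAltOfRecord F N θ.ν P.K j → chiβOfRecord₁₃ F N θ.toStage13Params P.K (gOfRecord₁₃ F N θ.toStage13Params P) j U = 0)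
    (hint : ∀ (P : B12.RunParams), ∀ j < P.K, Integrable (betaInputOfRecord F N (TβOfRecord₁₃ F N) (chiβOfRecord₁₃ F N θ.toStage13Params) P.K
      (gOfRecord₁₃ F N θ.toStage13Params P) j) (fieldMeasure (F.P P.K) j (SU N)))
    (hreg : ∀ (P : B12.RunParams), ∀ j < P.K, domAltOfRecord F N θ.ν P.K (j + 1) ⊆ regSetOfRecord F N P.K j
      (betaInputOfRecord F N (TβOfRecord₁₃ F N) (chiβOfRecord₁₃ F N θ.toStage13Params) P.K (gOfRecord₁₃ F N θ.toStage13Params P) j))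
    (h11 : ∀ (P : B12.RunParams) (k : ℕ), k ≤ P.K → ∀ V ∈ domAltOfRecord F N θ.ν P.K k, UkExists F N P.K k θ.εbg V ∧ UniqueUkOrbit F N P.K k θ.εbg V)
    (hεbg : 0 < θ.εbg)
    (hε3 : ∀ P : B12.RunParams, (143 * (((((F.P P.K).d + 4 : ℕ) : ℝ)) ^ 2 / 4) ^ 2) * θ.εbg ≤ 1 / 3)
    (hε2 : ∀ P : B12.RunParams, 2 * θ.εbg ≤ 2 * deltaSU (Fin N) / ((((F.P P.K).d + 4) * (F.P P.K).L : ℕ) : ℝ) ^ 2)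
    (hε₀ : ∀ P : B12.RunParams, 2 * θ.εbg ≤ θ.ν.ε₀ * ((F.P P.K).L : ℝ) ^ 2)
    (hB₃ : 0 ≤ B₃) (hεreg' : 0 < θ.toStage13Params.ν.εreg) (hra : 2 * θ.toStage13Params.ν.εreg ≤ a₁) (hB : 2 * B₃ * θ.toStage13Params.ν.εreg ≤ θ.εbg)
    (hhi : θ.εbg ≤ a₀) :
    ∀ P : B12.RunParams, (leavesP w P).smallCouplings → (leavesP w P).smallFieldInductive := by
  have hr3 : ∀ P : B12.RunParams, (143 * (((((F.P P.K).d + 4 : ℕ) : ℝ)) ^ 2 / 4) ^ 2) * θ.toStage13Params.ν.εreg ≤ 1 / 3 :=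
    fun P => (mul_le_mul_of_nonneg_left hle (by positivity)).trans (hε3 P)
  have hr2 : ∀ P : B12.RunParams, 2 * θ.toStage13Params.ν.εreg ≤ 2 * deltaSU (Fin N) / ((((F.P P.K).d + 4) * (F.P P.K).L : ℕ) : ℝ) ^ 2 :=
    fun P => (by linarith : 2 * θ.toStage13Params.ν.εreg ≤ 2 * θ.εbg).trans (hε2 P)
  exact thm3Member_forall_stage13SepCoPH_atDomAlt_of_thm1_of_reg8 θ h hC hε hreg8 hle hεreg hcov hχdom hint hreg h11
    (fun P k hk => hres_of_thm1Objects_of_ukRows_of_reg8 θ.toStage13Params.ν θ.εbg a₀ a₁ B₃ P.K (hT1 P) (hUk P) (fun k hk V hV => (h11 P k hk V hV).1)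
      (hreg8 P) hB₃ hεreg' (hr3 P) (hr2 P) hra hB hhi k hk)
    (fun P => huniq_of_h11 θ.toStage13Params.ν hεbg (hε3 P) (hε2 P) (hε₀ P) (h11 P))

end Summit.QuantumFields.YangMills.BalabanUVNodes.N09OnDomainsDoorOfLevelwiseThm1

end
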